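import Literature.MathematicalPhysics.QuantumFieldTheory.Balaban1983to89.T4GoodClassBudget

/-!
# T⁴ programme, spine estimate NE9 — THE ADAPTIVITY OF KING's WINDOW IS NECESSARY IN FULL GENERALITY: no window chosen independently of the
# E-side profile passes node U5b's rate-only slot for all admissible profiles — census item C40 (sharp form) of cell `pub-balaban-gaps`, seat ne9 (gen 11)

Cell `pub-balaban-gaps` (YM blitz G2, seat ne9, unit `pub-balaban-gaps-ne9-g11`; record `run/shared/lean/pub/pub-balaban-gaps/ne/NE9.md` §5 row C40).
Companion of this seat's `Spine/NE9/DirectPairingWindow.lean` (C40: for every profile `b_j → 0` there is a window width `m(K) → ∞` ADAPTED to `b` along which the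
rate-only recent-deviation window sum `Σ_{j=K−m(K)}^{K} b_j·Λ^{K−j}` tends to zero; a FIXED linear or logarithmic window fails for `b_j = 1∕(j+1)`).  This file is the
SHARP converse: for EVERY window `m(K) → ∞` fixed in advance (whatever its growth — linear `jstarOf`, logarithmic `jlogOf`, or slower) there is an admissible profile
(`b ≥ 0`, `b → 0`) whose window sum does NOT tend to zero (`Λ = 4`; `b_j = 2^{−M(j)}` with `M(j) = inf_{K ≥ j} m(K)`, so that the `j = K − m(K)` term is
`≥ 2^{−m(K)}·4^{m(K)} = 2^{m(K)} ≥ 1`).  Together with `DirectPairingWindow.boundedWindow_badBudget_not_tendsto` (the window must tend to infinity for the bad class)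
this shows that in King's currency the window MUST be chosen as a function of the E-side profile — the organisational freedom King's `W_K → 0` grants and the
consecutive `Σ W_K < ∞` design (one cut `jlogOf C` for all) does not use.  Elementary; NO definition; nothing of Bałaban's asserted.

HONEST FRAMING: bookkeeping for rung (B)+1 on ONE FIXED finite four-torus; real analysis on hypothesis SHAPES (H-U5b-1's window slot); NE9 NOT PRINTED ∕ NOT PROVED;
spine PROVED 0∕9 unchanged; NOT UV stability, NOT the continuum limit, NOT infinite volume, NOT a mass gap, NOT Clay.
-/

namespace Summit.QuantumFields.BalabanUV.T4Continuum.NE9.DirectPairingWindowSharp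

open scoped BigOperators
open Finset Filter Topology

/-- The running infimum `M j = inf_{K ≥ j} m K` of a window tending to infinity tends to infinity, and `M (K − m K) ≤ m K` whenever `m K ≤ K`. [folklore] -/
theorem runningInf_spec {m : ℕ → ℕ} (hm : Tendsto m atTop atTop) :
    Tendsto (fun j => sInf (m '' {K | j ≤ K})) atTop atTop ∧ ∀ K, m K ≤ K → sInf (m '' {K' | K - m K ≤ K'}) ≤ m K := by
  refine ⟨?_, fun K _ => Nat.sInf_le ⟨K, by simp, rfl⟩⟩
  rw [tendsto_atTop_atTop]
  intro N
  obtain ⟨K₀, hK₀⟩ := tendsto_atTop_atTop.mp hm N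
  refine ⟨K₀, fun j hj => ?_⟩
  have hne : (m '' {K | j ≤ K}).Nonempty := ⟨m j, j, (le_rfl : j ≤ j), rfl⟩
  refine le_csInf hne ?_
  rintro _ ⟨K, hK, rfl⟩
  exact hK₀ K (hj.trans hK)

/-- **ADAPTIVITY IS NECESSARY.**  For EVERY window `m K → ∞` with `m K ≤ K`, fixed independently of the profile, there is an admissible King profile — `b ≥ 0`, `b → 0` —
whose rate-only window sum with multiplicity base `Λ = 4` does NOT tend to zero: `b_j = 2^{−M(j)}`, `M(j) = inf_{K ≥ j} m K`; the `j = K − m K` term of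
`Σ_{j=K−m(K)}^{K} b_j·4^{K−j}` is `2^{−M(K−m K)}·4^{m K} ≥ 2^{−m K}·4^{m K} = 2^{m K} ≥ 1`. [folklore] -/
theorem adaptivity_necessary {m : ℕ → ℕ} (hm : Tendsto m atTop atTop) (hmK : ∀ K, m K ≤ K) :
    ∃ b : ℕ → ℝ, (∀ j, 0 ≤ b j) ∧ Tendsto b atTop (𝓝 0) ∧
      ¬ Tendsto (fun K => ∑ j ∈ Icc (K - m K) K, b j * (4 : ℝ) ^ (K - j)) atTop (𝓝 0) := by
  obtain ⟨hM, hMle⟩ := runningInf_spec hm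
  set M : ℕ → ℕ := fun j => sInf (m '' {K | j ≤ K}) with hMdef
  refine ⟨fun j => (1 / 2 : ℝ) ^ M j, fun j => by positivity, ?_, ?_⟩
  · -- `b → 0`: `(1/2)^{M j}` with `M j → ∞`
    exact (tendsto_pow_atTop_nhds_zero_of_lt_one (by norm_num) (by norm_num)).comp hM
  · intro h
    have hge : ∀ K : ℕ, (1 : ℝ) ≤ ∑ j ∈ Icc (K - m K) K, (1 / 2 : ℝ) ^ M j * (4 : ℝ) ^ (K - j) := by
      intro K
      have hmem : K - m K ∈ Icc (K - m K) K := by rw [mem_Icc]; omega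
      have hterm : (1 : ℝ) ≤ (1 / 2 : ℝ) ^ M (K - m K) * (4 : ℝ) ^ (K - (K - m K)) := by
        rw [show K - (K - m K) = m K by have := hmK K; omega]
        have h1 : (1 / 2 : ℝ) ^ m K ≤ (1 / 2 : ℝ) ^ M (K - m K) :=
          pow_le_pow_of_le_one (by norm_num) (by norm_num) (hMle K (hmK K))
        have h2 : (1 : ℝ) ≤ (1 / 2 : ℝ) ^ m K * (4 : ℝ) ^ m K := by
          rw [← mul_pow]; norm_num; exact one_le_pow₀ (by norm_num)
        exact h2.trans (mul_le_mul_of_nonneg_right h1 (by positivity))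
      exact hterm.trans (single_le_sum (f := fun j => (1 / 2 : ℝ) ^ M j * (4 : ℝ) ^ (K - j)) (fun j _ => by positivity) hmem)
    obtain ⟨K, hK⟩ := (h.eventually (gt_mem_nhds (show (0 : ℝ) < 1 by norm_num))).exists
    exact absurd (hge K) (not_le.mpr hK)

/-- **THE WINDOW MUST BE A FUNCTION OF THE PROFILE.**  Packaging: a bounded window keeps the bad-class budget away from zero (`0 < r₀ < 1`, `V > 0`), and an unbounded
window fixed in advance is defeated by some admissible profile (`adaptivity_necessary`) — so no single window serves all profiles; King's organisation chooses it after
`b` (`DirectPairingWindow.exists_kingWindow`). [folklore] -/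
theorem no_universal_window {m : ℕ → ℕ} (hmK : ∀ K, m K ≤ K) {r₀ V : ℝ} (h0 : 0 < r₀) (h1 : r₀ < 1) (hV : 0 < V) :
    (Tendsto (fun K => V * r₀ ^ m K) atTop (𝓝 0) → Tendsto m atTop atTop) ∧
    (Tendsto m atTop atTop → ∃ b : ℕ → ℝ, (∀ j, 0 ≤ b j) ∧ Tendsto b atTop (𝓝 0) ∧
      ¬ Tendsto (fun K => ∑ j ∈ Icc (K - m K) K, b j * (4 : ℝ) ^ (K - j)) atTop (𝓝 0)) := by
  refine ⟨fun h => ?_, fun hm => adaptivity_necessary hm hmK⟩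
  -- if `V r₀^{m K} → 0` then `m K → ∞`: otherwise some value `N` is hit infinitely often and the budget stays `≥ V r₀^N` there
  rw [tendsto_atTop_atTop]
  by_contra hnot
  simp only [not_forall, not_exists, not_le] at hnot
  obtain ⟨N, hN⟩ := hnot
  have hpos : 0 < V * r₀ ^ N := mul_pos hV (pow_pos h0 N)
  have hev := h.eventually (gt_mem_nhds hpos)
  obtain ⟨K₀, hK₀⟩ := hev.exists_forall_of_atTop
  obtain ⟨K, hK, hmK'⟩ := hN K₀
  have hle : V * r₀ ^ N ≤ V * r₀ ^ m K :=
    mul_le_mul_of_nonneg_left (pow_le_pow_of_le_one h0.le h1.le hmK'.le) hV.le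
  exact absurd hle (not_le.mpr (hK₀ K hK))

end Summit.QuantumFields.BalabanUV.T4Continuum.NE9.DirectPairingWindowSharp
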